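import Summits.CriticalPhenomena.PercolationContinuityZ3.Theorems.PercNearOneGluingNoHeavyLowerTailSahiCombTriWGeneral

/-!
# The DIAGONAL of `TRI_W(a)`: `0 ≤ triW P F F` for every `a`, every cube, every family of up-sets

Support file of the one-cut programme (crux `NoHeavyLowerTail`, stmt-CriticalPhenomena-4575; cell `prim-masterthm`, seat P5 gen 13;
report `P5-LORENTZIAN-TEST.md` §18).

`FiveUpSet.triW P F G` (`…SahiCombTriWGeneral`) is BILINEAR in the pair of indicator families `(1_{F x})_x`, `(1_{G x})_x`, so the open
target `FiveUpSet.TriWIneq` says that a bilinear form is non-negative on (monotone families) × (monotone families).  This file settles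
its diagonal `G = F` unconditionally, with a one-line mechanism:

* `FiveUpSet.card_sdiff_inter_cast` — bookkeeping `#((P \ R) ∩ A) = #(P ∩ A) − #(P ∩ A ∩ R)` (over `ℤ`);
* **`FiveUpSet.triW_self_eq`** — the diagonal in closed form:
  `triW P F F = Σ_x ( 2·#((P \ refl (F xᶜ)) ∩ F x) − #((P \ refl (F xᶜ)) ∩ refl (F x)) )`
  (the two mixed terms `#(P ∩ refl (F x) ∩ F xᶜ)`, `#(P ∩ F x ∩ refl (F xᶜ))` of `triWTerm` coincide after the re-indexing `x ↦ xᶜ`);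
* **`FiveUpSet.triW_self_ge`** — `Σ_x #((P \ refl (F xᶜ)) ∩ F x) ≤ triW P F F`: for each `x` the family `U_x := P \ refl (F xᶜ)` is an
  UP-SET (an up-set minus a down-set), so Kleitman's antipodal lemma `card_inter_refl_le` inside `U_x` gives
  `#(U_x ∩ refl (F x)) ≤ #(U_x ∩ F x)`;
* **`FiveUpSet.triW_self_nonneg`** — `0 ≤ triW P F F` for every up-set `P` and EVERY family `x ↦ F x` of up-sets (no monotonicity in
  `x` is needed, every index cube `Finset β`, every cube `Finset γ`).
In the `Ω = X × W` dictionary of the report (§14.1, §18): `triW P F F = 2·#(𝒫 ∩ 𝔽 \ c𝔽) − #(𝒫 ∩ c𝔽 \ κ_W 𝔽)` and the file proves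
`#(𝒫 ∩ c𝔽 \ κ_W𝔽) ≤ #(𝒫 ∩ 𝔽 \ c𝔽)` (census: equality is attained; exhaustive `(a,n) ∈ {(1,2),(2,1),(2,2),(1,3),(3,1),(1,4)}`, sampled
`(2,3),(3,2)`).  This stratum is not contained in the known ones (`triW_nonneg_of_pairwise_nested`, `triW_nonneg_of_refl_subset`):
`F x` and `F xᶜ` may be incomparable and `P` arbitrary.
HONEST LABEL: an identity and one Kleitman estimate per index; the diagonal of a bilinear form says nothing about its off-diagonal values
on a cone, so `TriWIneq` (a ≥ 2) remains OPEN and is NOT advanced by this file beyond the stratum `G = F`. [this work]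
-/

namespace Summit.CriticalPhenomena.PercolationContinuityZ3.Theorems

namespace FiveUpSet

open Finset

variable {β γ : Type} [DecidableEq β] [Fintype β] [DecidableEq γ] [Fintype γ]

omit [Fintype γ] in
/-- Bookkeeping: `#((P \ R) ∩ A) = #(P ∩ A) − #(P ∩ A ∩ R)` over `ℤ`. [this work] -/
theorem card_sdiff_inter_cast (P A R : Finset (Finset γ)) :
    (((P \ R) ∩ A).card : ℤ) = (P ∩ A).card - (P ∩ A ∩ R).card := by
  have h1 : (P \ R) ∩ A = (P ∩ A) \ R := by
    ext s
    simp only [mem_inter, mem_sdiff]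
    tauto
  have h2 : ((P ∩ A) \ R).card + ((P ∩ A) ∩ R).card = (P ∩ A).card := card_sdiff_add_card_inter _ _
  rw [h1]
  omega

/-- For an up-set `P` and an up-set `A`, the family `P \ refl A` (an up-set minus a down-set) is an up-set. [this work] -/
theorem isUpperSet_sdiff_refl {P A : Finset (Finset γ)} (hP : IsUpperSet (P : Set (Finset γ)))
    (hA : IsUpperSet (A : Set (Finset γ))) : IsUpperSet ((P \ refl A : Finset (Finset γ)) : Set (Finset γ)) := by
  intro s t hst hs
  rw [mem_coe, mem_sdiff] at hs ⊢
  exact ⟨hP hst hs.1, fun ht => hs.2 (isLowerSet_refl hA hst ht)⟩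

/-- **The diagonal of `TRI_W(a)` in closed form** (no hypothesis on `P`, `F`):
`triW P F F = Σ_x ( 2·#((P \ refl (F xᶜ)) ∩ F x) − #((P \ refl (F xᶜ)) ∩ refl (F x)) )`. [this work] -/
theorem triW_self_eq (P : Finset (Finset γ)) (F : Finset β → Finset (Finset γ)) :
    triW P F F = ∑ x : Finset β, (2 * ((((P \ refl (F xᶜ)) ∩ F x).card : ℤ)) - ((P \ refl (F xᶜ)) ∩ refl (F x)).card) := by
  -- the two mixed terms of `triWTerm P F F` agree after re-indexing `x ↦ xᶜ`
  have h3 : ∑ x : Finset β, ((P ∩ refl (F x) ∩ F xᶜ).card : ℤ)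
      = ∑ x : Finset β, ((P ∩ F x ∩ refl (F xᶜ)).card : ℤ) := by
    refine Fintype.sum_equiv (complEquiv β) _ _ (fun x => ?_)
    show ((P ∩ refl (F x) ∩ F xᶜ).card : ℤ) = ((P ∩ F xᶜ ∩ refl (F xᶜᶜ)).card : ℤ)
    rw [compl_compl, inter_assoc, inter_comm (refl (F x)), ← inter_assoc]
  -- per-index bookkeeping
  have hx : ∀ x : Finset β, triWTerm P F F x
      = (2 * ((((P \ refl (F xᶜ)) ∩ F x).card : ℤ)) - ((P \ refl (F xᶜ)) ∩ refl (F x)).card)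
        + ((((P ∩ F x ∩ refl (F xᶜ)).card : ℤ)) - (P ∩ refl (F x) ∩ F xᶜ).card) := by
    intro x
    unfold triWTerm
    have e1 : P ∩ F x ∩ F x = P ∩ F x := by rw [inter_assoc, inter_self]
    have e2 : P ∩ refl (F x) ∩ refl (F x) = P ∩ refl (F x) := by rw [inter_assoc, inter_self]
    rw [e1, e2, card_sdiff_inter_cast P (F x) (refl (F xᶜ)), card_sdiff_inter_cast P (refl (F x)) (refl (F xᶜ))]
    ring
  have h0 : ∑ x : Finset β, ((((P ∩ F x ∩ refl (F xᶜ)).card : ℤ)) - (P ∩ refl (F x) ∩ F xᶜ).card) = 0 := by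
    rw [sum_sub_distrib, h3, sub_self]
  unfold triW
  rw [sum_congr rfl (fun x _ => hx x), sum_add_distrib, h0, add_zero]

/-- **The diagonal is at least a sum of `2^a` non-negative terms**: for an up-set `P` and up-sets `F x`,
`Σ_x #((P \ refl (F xᶜ)) ∩ F x) ≤ triW P F F` — Kleitman's antipodal lemma inside each up-set `P \ refl (F xᶜ)`. [this work] -/
theorem triW_self_ge (P : Finset (Finset γ)) (F : Finset β → Finset (Finset γ))
    (hP : IsUpperSet (P : Set (Finset γ))) (hF : ∀ x, IsUpperSet (F x : Set (Finset γ))) :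
    ∑ x : Finset β, ((((P \ refl (F xᶜ)) ∩ F x).card : ℤ)) ≤ triW P F F := by
  rw [triW_self_eq, ← sub_nonneg, ← sum_sub_distrib]
  refine sum_nonneg fun x _ => ?_
  have hk := card_inter_refl_le (isUpperSet_sdiff_refl hP (hF xᶜ)) (hF x)
  have hk' : ((((P \ refl (F xᶜ)) ∩ refl (F x)).card : ℤ)) ≤ (((P \ refl (F xᶜ)) ∩ F x).card : ℤ) := by exact_mod_cast hk
  linarith

/-- **The diagonal stratum of `TriWIneq`, every `a`, unconditional**: `0 ≤ triW P F F` for every up-set `P` of any cube and EVERY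
family `x ↦ F x` of up-sets over any index cube (monotonicity in `x` is not needed). [this work] -/
theorem triW_self_nonneg (P : Finset (Finset γ)) (F : Finset β → Finset (Finset γ))
    (hP : IsUpperSet (P : Set (Finset γ))) (hF : ∀ x, IsUpperSet (F x : Set (Finset γ))) :
    0 ≤ triW P F F :=
  le_trans (sum_nonneg fun _ _ => by positivity) (triW_self_ge P F hP hF)

end FiveUpSet

end Summit.CriticalPhenomena.PercolationContinuityZ3.Theorems
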